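import Summits.SmoothPoincare4.SmoothPoincare4.Theorems.CongruenceShadowsShadowApproximationStubLayerStepTwoZeroRealisers
import HarnessLib

/-!
# Helper for stub `stub_layerStepBlockZero` (line `nilpotent-genus-class`, crux
`CongruenceShadows.ShadowApproximation`, item stmt-SmoothPoincare4-14595):
# conjugated seed realisers at EVERY genus `3 + 3m` and their collapsed readings

`S = SurfaceGroup (3+3m)`, `N i = s4Kernels.stabilizeIter m i`, `H₁ = ℤ^{Fin (3+3m) × Bool}`, `γₖ₊₁ = (⊤).lowerCentralSeries k`,
`π` the erasing projection of the slot-`2` cut pattern `ct`.  The genus-`6`/`9` files of the `(1,0)`/`(2,0)` layer steps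
(`exists_conj_realiser`, `exists_conj_realiser₉`, `exists_perm_conj_realiser₉`) are uniform in the genus except for the
numeral and for the seed handle `k + 1 : Fin (3+3m)` (whose `1` needs `NeZero (3+3m)`); here they are restated and
re-proved at every genus `3 + 3m` with the second seed handle an explicit `k'` (`k' ≡ k + 1`):

* §1 `exists_bp_pair` — the bounding-pair map on the handles `k, k'` of `S_g`, `g = n + 3`, `k' = k + 1 (mod g)`
  (the landed `exists_bp_handle`, transported along `g = n + 3`).
* §2 `exists_conj_realiser_g` — for an integer matrix `M` passing the decidable Goeritz checks (realised by
  `x ∈ Stab N₀ ∩ Stab N₁`, landed `exists_goeritz_of_matrix`) the conjugate `y = x bp_{k,k'} x⁻¹ ∈ Stab N₀ ∩ Stab N₁` is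
  IA and reads as the closed form `RD(M, M', k, k')` (landed `johnson_conj_seed`, `reading_of_table`).
* §3 `exists_perm_conj_realiser_g` — the same for the row-permuted matrix `P_σ M` of a residue-preserving handle
  permutation `τ` (inverse `σ`), with the reading in the COLLAPSED closed form
  `RD'(j, v, w) = s_j (E'(j,v,w) - E'(j,w,v))`,
  `E'(j,p,q) = M'_{(k,a)}^{τj} M^{τp}_{(k,a)} M^{τq}_{(k',b)} - M'_{(k,b)}^{τj} M^{τp}_{(k',b)} M^{τq}_{(k,b)} + M'_{(k',a)}^{τj} M^{τp}_{(k,b)} M^{τq}_{(k,a)}`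
  (landed `perm_mul_eq_one`, `perm_symplForm_col`, `perm_block`, `sum_mul_pairing_true/false`).
No definitions; the registered helper is `helper_bpPair`.
-/

set_option linter.dupNamespace false

noncomputable section

open Subgroup Literature.Topology.FourManifolds Literature.Algebra.Lie Multiplicative
open Summit.SmoothPoincare4.SmoothPoincare4.Theorems.NilpotentShadowsStandard.SaturatedTorsorDescent
open scoped commutatorElement

namespace Summit.SmoothPoincare4.SmoothPoincare4.Theorems.ShadowApproximation.NilpotentGenusClass

/-! ## §1 The bounding-pair map on the handles `k, k' = k + 1` of `S_g`, `g = n + 3` -/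

section Seed

/-- **The bounding-pair map on the handles `k, k'`** of `S_g` (`g = n + 3`, `k' ≡ k + 1 (mod g)`): an IA-automorphism
realising the letter triple `(b_k, a_k, b_{k'})` and stabilising every cut kernel (the landed `exists_bp_handle`,
transported along `g = n + 3`). [folklore] -/
theorem exists_bp_pair {g : ℕ} (n : ℕ) (hg : g = n + 3) (k k' : Fin g) (hkk' : ((k' : Fin g) : ℕ) = (((k : Fin g) : ℕ) + 1) % g) :
    ∃ β : SurfaceGroup g ≃* SurfaceGroup g, (∀ s : SurfaceGroup g, β s * s⁻¹ ∈ (⊤ : Subgroup (SurfaceGroup g)).lowerCentralSeries 1) ∧ (∀ x : Fin g × Bool, β (PresentedGroup.of x : SurfaceGroup g) * (PresentedGroup.of x : SurfaceGroup g)⁻¹ * (⁅(PresentedGroup.of (k, false) : SurfaceGroup g), (PresentedGroup.of (k', true) : SurfaceGroup g)⁆ ^ (if x.1 = (k, true).1 ∧ x.2 = false ∧ (k, true).2 = true then (1 : ℤ) else if x.1 = (k, true).1 ∧ x.2 = true ∧ (k, true).2 = false then (-1 : ℤ) else 0) * ⁅(PresentedGroup.of (k', true) : SurfaceGroup g), (PresentedGroup.of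 (k, true) : SurfaceGroup g)⁆ ^ (if x.1 = (k, false).1 ∧ x.2 = false ∧ (k, false).2 = true then (1 : ℤ) else if x.1 = (k, false).1 ∧ x.2 = true ∧ (k, false).2 = false then (-1 : ℤ) else 0) * ⁅(PresentedGroup.of (k, true) : SurfaceGroup g), (PresentedGroup.of (k, false) : SurfaceGroup g)⁆ ^ (if x.1 = (k', true).1 ∧ x.2 = false ∧ (k', true).2 = true then (1 : ℤ) else if x.1 = (k', true).1 ∧ x.2 = true ∧ (k', true).2 = false then (-1 : ℤ) else 0))⁻¹ ∈ (⊤ : Subgroup (SurfaceGroup g)).lowerCentralSeries 2) ∧ ∀ c : Fin g → Bool, (SurfaceGroup.cutKernel c).map β.toMonoidHom = SurfaceGroup.cutKernel c := by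
  subst hg
  obtain rfl : k' = k + 1 := Fin.ext (by rw [hkk', Fin.val_add, Fin.val_one])
  exact exists_bp_handle n k

end Seed

/-! ## §2 Conjugated seed realisers at genus `3 + 3m` -/

section ConjRealiser

variable {m : ℕ}

/-- **A conjugated seed realiser and its reading** (every genus `3 + 3m`; the genus-`6`/`9` twins are the landed
`exists_conj_realiser`, `exists_conj_realiser₉`).  For a matrix `M` as in `exists_goeritz_of_matrix` (realised by
`x ∈ Stab N₀ ∩ Stab N₁`) and handles `k, k' ≡ k + 1`, the conjugate `y = x β x⁻¹` of the bounding-pair map `β = bp_{k,k'}`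
lies in `Stab N₀ ∩ Stab N₁`, is IA, and for the cut pattern `ct` of slot `2` with erasing projection `π` its corrections at
the cut letters read as the pair products of the closed-form reading `RD(M, M', k, k') j v w = s_j · (E(x_j, y_v, y_w) - E(x_j, y_w, y_v))`,
`E` the conjugated Johnson table of `johnson_conj_seed` for the triple `(b_k, a_k, b_{k'})`, `s_j = -1` on `b`-cut handles.
[folklore] -/
theorem exists_conj_realiser_g (k k' : Fin (3 + 3 * m)) (hkk' : ((k' : Fin (3 + 3 * m)) : ℕ) = (((k : Fin (3 + 3 * m)) : ℕ) + 1) % (3 + 3 * m)) (M M' : Matrix (Fin (3 + 3 * m) × Bool) (Fin (3 + 3 * m) × Bool) ℤ)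
    (ε : ℤ) (hε : ε = 1 ∨ ε = -1) (h1 : M * M' = 1) (h2 : M' * M = 1)
    (hS : ∀ x y : Fin (3 + 3 * m) × Bool, symplForm (fun k => M k x) (fun k => M k y) =
      ε * symplForm (Pi.single x (1 : ℤ) : Fin (3 + 3 * m) × Bool → ℤ) (Pi.single y (1 : ℤ)))
    (h0 : ∀ i j : Fin (3 + 3 * m), M (i, !decide ((i : ℕ) % 3 = 2)) (j, decide ((j : ℕ) % 3 = 2)) = 0)
    (h1' : ∀ i j : Fin (3 + 3 * m), M (i, !decide ((i : ℕ) % 3 = 1)) (j, decide ((j : ℕ) % 3 = 1)) = 0)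
    {ct : Fin (3 + 3 * m) → Bool} {π : (SurfaceGroup (3 + 3 * m)) →* (FreeGroup (Fin (3 + 3 * m)))} (hπs : Function.Surjective π)
    (hπof : ∀ (h : Fin (3 + 3 * m)) (b : Bool), π (PresentedGroup.of (h, b)) = if b = ct h then 1 else FreeGroup.of h) :
    ∃ y : (SurfaceGroup (3 + 3 * m)) ≃* (SurfaceGroup (3 + 3 * m)),
      (s4Kernels.stabilizeIter m 0).map y.toMonoidHom = s4Kernels.stabilizeIter m 0 ∧
      (s4Kernels.stabilizeIter m 1).map y.toMonoidHom = s4Kernels.stabilizeIter m 1 ∧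
      (∀ s : (SurfaceGroup (3 + 3 * m)), y s * s⁻¹ ∈ ((⊤ : Subgroup (SurfaceGroup (3 + 3 * m))).lowerCentralSeries 1)) ∧
      ∀ j : Fin (3 + 3 * m), π (y (PresentedGroup.of (j, ct j)) * (PresentedGroup.of (j, ct j))⁻¹) *
        (((List.finRange (3 + 3 * m)).map (fun v => ((List.finRange (3 + 3 * m)).map (fun w => if v < w then ⁅(FreeGroup.of v : FreeGroup (Fin (3 + 3 * m))), FreeGroup.of w⁆ ^ ( (if ct j then (-1 : ℤ) else 1) * ((if ct j then (-1 : ℤ) else 1) * (((∑ x : Fin (3 + 3 * m) × Bool, M' x (j, ct j) * (if x.1 = ((k : Fin (3 + 3 * m)), true).1 ∧ x.2 = false ∧ ((k : Fin (3 + 3 * m)), true).2 = true then (1 : ℤ) else if x.1 = ((k : Fin (3 + 3 * m)), true).1 ∧ x.2 = true ∧ ((k : Fin (3 + 3 * m)), true).2 = false then (-1 : ℤ) else 0)) * (M (v, !ct v) ((k : Fin (3 + 3 * m)), false) * M (w, !ct w) ((k' : Fin (3 + 3 * m)), true)) + (∑ x : Fin (3 + 3 * m) × Bool, M' x (j, ct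 j) * (if x.1 = ((k : Fin (3 + 3 * m)), false).1 ∧ x.2 = false ∧ ((k : Fin (3 + 3 * m)), false).2 = true then (1 : ℤ) else if x.1 = ((k : Fin (3 + 3 * m)), false).1 ∧ x.2 = true ∧ ((k : Fin (3 + 3 * m)), false).2 = false then (-1 : ℤ) else 0)) * (M (v, !ct v) ((k' : Fin (3 + 3 * m)), true) * M (w, !ct w) ((k : Fin (3 + 3 * m)), true)) + (∑ x : Fin (3 + 3 * m) × Bool, M' x (j, ct j) * (if x.1 = ((k' : Fin (3 + 3 * m)), true).1 ∧ x.2 = false ∧ ((k' : Fin (3 + 3 * m)), true).2 = true then (1 : ℤ) else if x.1 = ((k' : Fin (3 + 3 * m)), true).1 ∧ x.2 = true ∧ ((k' : Fin (3 + 3 * m)), true).2 = false then (-1 : ℤ) else 0)) * (M (v, !ct v) ((k : Fin (3 + 3 * m)), true) * M (w, !ct w) ((k : Fin (3 + 3 * m)), false))) - ((∑ x : Fin (3 + 3 * m) × Bool, M' x (j, ct j) * (if x.1 = ((k : Fin (3 + 3 * m)), true).1 ∧ x.2 = false ∧ ((k : Fin (3 + 3 * m)), true).2 = true then (1 : ℤ)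 else if x.1 = ((k : Fin (3 + 3 * m)), true).1 ∧ x.2 = true ∧ ((k : Fin (3 + 3 * m)), true).2 = false then (-1 : ℤ) else 0)) * (M (w, !ct w) ((k : Fin (3 + 3 * m)), false) * M (v, !ct v) ((k' : Fin (3 + 3 * m)), true)) + (∑ x : Fin (3 + 3 * m) × Bool, M' x (j, ct j) * (if x.1 = ((k : Fin (3 + 3 * m)), false).1 ∧ x.2 = false ∧ ((k : Fin (3 + 3 * m)), false).2 = true then (1 : ℤ) else if x.1 = ((k : Fin (3 + 3 * m)), false).1 ∧ x.2 = true ∧ ((k : Fin (3 + 3 * m)), false).2 = false then (-1 : ℤ) else 0)) * (M (w, !ct w) ((k' : Fin (3 + 3 * m)), true) * M (v, !ct v) ((k : Fin (3 + 3 * m)), true)) + (∑ x : Fin (3 + 3 * m) × Bool, M' x (j, ct j) * (if x.1 = ((k' : Fin (3 + 3 * m)), true).1 ∧ x.2 = false ∧ ((k' : Fin (3 + 3 * m)), true).2 = true then (1 : ℤ) else if x.1 = ((k' : Fin (3 + 3 * m)), true).1 ∧ x.2 = true ∧ ((k' : Fin (3 + 3 * m)), true).2 = false then (-1 : ℤ)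 else 0)) * (M (w, !ct w) ((k : Fin (3 + 3 * m)), true) * M (v, !ct v) ((k : Fin (3 + 3 * m)), false))))) ) else (1 : FreeGroup (Fin (3 + 3 * m))))).prod)).prod)⁻¹ ∈ ((⊤ : Subgroup (FreeGroup (Fin (3 + 3 * m)))).lowerCentralSeries 2) := by
  obtain ⟨x, hx0, hx1, hM, hM'⟩ := exists_goeritz_of_matrix (m := m) M M' ε hε h1 h2 hS h0 h1'
  obtain ⟨β, hβIA, hβτ, hβcut⟩ := exists_bp_pair (3 * m) (by ring) k k' hkk'
  have hβ0 : (s4Kernels.stabilizeIter m 0).map β.toMonoidHom = s4Kernels.stabilizeIter m 0 := by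
    rw [stabilizeIter_eq_cutKernel]; exact hβcut _
  have hβ1 : (s4Kernels.stabilizeIter m 1).map β.toMonoidHom = s4Kernels.stabilizeIter m 1 := by
    rw [stabilizeIter_eq_cutKernel]; exact hβcut _
  obtain ⟨cS, hcS⟩ : ∃ cS : Fin (3 + 3 * m) × Bool → Fin (3 + 3 * m) × Bool → (Subgroup.center (SurfaceGroup (3 + 3 * m) ⧸ (⊤ : Subgroup (SurfaceGroup (3 + 3 * m))).lowerCentralSeries 2)),
      ∀ p q, (cS p q : (SurfaceGroup (3 + 3 * m) ⧸ (⊤ : Subgroup (SurfaceGroup (3 + 3 * m))).lowerCentralSeries 2)) = ⁅((PresentedGroup.of p : (SurfaceGroup (3 + 3 * m))) : (SurfaceGroup (3 + 3 * m) ⧸ (⊤ : Subgroup (SurfaceGroup (3 + 3 * m))).lowerCentralSeries 2)), ((PresentedGroup.of q : (SurfaceGroup (3 + 3 * m))) : (SurfaceGroup (3 + 3 * m) ⧸ (⊤ : Subgroup (SurfaceGroup (3 + 3 * m))).lowerCentralSeries 2))⁆ :=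
    ⟨fun p q => ⟨_, c2_mem_center quot_class_two _ _⟩, fun p q => rfl⟩
  refine ⟨x.symm.trans (β.trans x), map_conj_of_map_eq x β hx0 hβ0, map_conj_of_map_eq x β hx1 hβ1, ia_conj hβIA x,
    fun j => ?_⟩
  have hE := johnson_conj_seed (k, true) (k, false) (k', true) β x hβIA hβτ M M' hM hM' cS hcS
  have hread := reading_of_table ct π hπs hπof (x.symm.trans (β.trans x)) cS hcS _ hE j
  have key : (((List.finRange (3 + 3 * m)).map (fun v => ((List.finRange (3 + 3 * m)).map (fun w => if v < w then ⁅(FreeGroup.of v : FreeGroup (Fin (3 + 3 * m))), FreeGroup.of w⁆ ^ ( (if ct j then (-1 : ℤ) else 1) * ((if ct j then (-1 : ℤ) else 1) * (((∑ x : Fin (3 + 3 * m) × Bool, M' x (j, ct j) * (if x.1 = ((k : Fin (3 + 3 * m)), true).1 ∧ x.2 = false ∧ ((k : Fin (3 + 3 * m)), true).2 = true then (1 : ℤ) else if x.1 = ((k : Fin (3 + 3 * m)), true).1 ∧ x.2 = true ∧ ((k : Fin (3 + 3 * m)), true).2 = false then (-1 : ℤ) else 0)) * (M (v, !ct v) ((k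 : Fin (3 + 3 * m)), false) * M (w, !ct w) ((k' : Fin (3 + 3 * m)), true)) + (∑ x : Fin (3 + 3 * m) × Bool, M' x (j, ct j) * (if x.1 = ((k : Fin (3 + 3 * m)), false).1 ∧ x.2 = false ∧ ((k : Fin (3 + 3 * m)), false).2 = true then (1 : ℤ) else if x.1 = ((k : Fin (3 + 3 * m)), false).1 ∧ x.2 = true ∧ ((k : Fin (3 + 3 * m)), false).2 = false then (-1 : ℤ) else 0)) * (M (v, !ct v) ((k' : Fin (3 + 3 * m)), true) * M (w, !ct w) ((k : Fin (3 + 3 * m)), true)) + (∑ x : Fin (3 + 3 * m) × Bool, M' x (j, ct j) * (if x.1 = ((k' : Fin (3 + 3 * m)), true).1 ∧ x.2 = false ∧ ((k' : Fin (3 + 3 * m)), true).2 = true then (1 : ℤ) else if x.1 = ((k' : Fin (3 + 3 * m)), true).1 ∧ x.2 = true ∧ ((k' : Fin (3 + 3 * m)), true).2 = false then (-1 : ℤ) else 0)) * (M (v, !ct v) ((k : Fin (3 + 3 * m)), true) * M (w, !ct w) ((k : Fin (3 + 3 * m)), false))) - ((∑ x : Fin (3 + 3 * m) × Bool, M' x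 (j, ct j) * (if x.1 = ((k : Fin (3 + 3 * m)), true).1 ∧ x.2 = false ∧ ((k : Fin (3 + 3 * m)), true).2 = true then (1 : ℤ) else if x.1 = ((k : Fin (3 + 3 * m)), true).1 ∧ x.2 = true ∧ ((k : Fin (3 + 3 * m)), true).2 = false then (-1 : ℤ) else 0)) * (M (w, !ct w) ((k : Fin (3 + 3 * m)), false) * M (v, !ct v) ((k' : Fin (3 + 3 * m)), true)) + (∑ x : Fin (3 + 3 * m) × Bool, M' x (j, ct j) * (if x.1 = ((k : Fin (3 + 3 * m)), false).1 ∧ x.2 = false ∧ ((k : Fin (3 + 3 * m)), false).2 = true then (1 : ℤ) else if x.1 = ((k : Fin (3 + 3 * m)), false).1 ∧ x.2 = true ∧ ((k : Fin (3 + 3 * m)), false).2 = false then (-1 : ℤ) else 0)) * (M (w, !ct w) ((k' : Fin (3 + 3 * m)), true) * M (v, !ct v) ((k : Fin (3 + 3 * m)), true)) + (∑ x : Fin (3 + 3 * m) × Bool, M' x (j, ct j) * (if x.1 = ((k' : Fin (3 + 3 * m)), true).1 ∧ x.2 = false ∧ ((k' : Fin (3 + 3 * m)), true).2 = true then (1 :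 ℤ) else if x.1 = ((k' : Fin (3 + 3 * m)), true).1 ∧ x.2 = true ∧ ((k' : Fin (3 + 3 * m)), true).2 = false then (-1 : ℤ) else 0)) * (M (w, !ct w) ((k : Fin (3 + 3 * m)), true) * M (v, !ct v) ((k : Fin (3 + 3 * m)), false))))) ) else (1 : FreeGroup (Fin (3 + 3 * m))))).prod)).prod) = (((List.finRange (3 + 3 * m)).map (fun v => ((List.finRange (3 + 3 * m)).map (fun w => if v < w then ⁅(FreeGroup.of v : FreeGroup (Fin (3 + 3 * m))), FreeGroup.of w⁆ ^ ( (((∑ x : Fin (3 + 3 * m) × Bool, M' x (j, ct j) * (if x.1 = ((k : Fin (3 + 3 * m)), true).1 ∧ x.2 = false ∧ ((k : Fin (3 + 3 * m)), true).2 = true then (1 : ℤ) else if x.1 = ((k : Fin (3 + 3 * m)), true).1 ∧ x.2 = true ∧ ((k : Fin (3 + 3 * m)), true).2 = false then (-1 : ℤ) else 0)) * (M (v, !ct v) ((k : Fin (3 + 3 * m)), false) * M (w, !ct w) ((k' : Fin (3 + 3 * m)), true)) + (∑ x : Fin (3 + 3 * m) × Bool, M' x (j, ct j) * (if x.1 =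 ((k : Fin (3 + 3 * m)), false).1 ∧ x.2 = false ∧ ((k : Fin (3 + 3 * m)), false).2 = true then (1 : ℤ) else if x.1 = ((k : Fin (3 + 3 * m)), false).1 ∧ x.2 = true ∧ ((k : Fin (3 + 3 * m)), false).2 = false then (-1 : ℤ) else 0)) * (M (v, !ct v) ((k' : Fin (3 + 3 * m)), true) * M (w, !ct w) ((k : Fin (3 + 3 * m)), true)) + (∑ x : Fin (3 + 3 * m) × Bool, M' x (j, ct j) * (if x.1 = ((k' : Fin (3 + 3 * m)), true).1 ∧ x.2 = false ∧ ((k' : Fin (3 + 3 * m)), true).2 = true then (1 : ℤ) else if x.1 = ((k' : Fin (3 + 3 * m)), true).1 ∧ x.2 = true ∧ ((k' : Fin (3 + 3 * m)), true).2 = false then (-1 : ℤ) else 0)) * (M (v, !ct v) ((k : Fin (3 + 3 * m)), true) * M (w, !ct w) ((k : Fin (3 + 3 * m)), false))) - ((∑ x : Fin (3 + 3 * m) × Bool, M' x (j, ct j) * (if x.1 = ((k : Fin (3 + 3 * m)), true).1 ∧ x.2 = false ∧ ((k : Fin (3 + 3 * m)), true).2 = true then (1 : ℤ) else if x.1 =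 ((k : Fin (3 + 3 * m)), true).1 ∧ x.2 = true ∧ ((k : Fin (3 + 3 * m)), true).2 = false then (-1 : ℤ) else 0)) * (M (w, !ct w) ((k : Fin (3 + 3 * m)), false) * M (v, !ct v) ((k' : Fin (3 + 3 * m)), true)) + (∑ x : Fin (3 + 3 * m) × Bool, M' x (j, ct j) * (if x.1 = ((k : Fin (3 + 3 * m)), false).1 ∧ x.2 = false ∧ ((k : Fin (3 + 3 * m)), false).2 = true then (1 : ℤ) else if x.1 = ((k : Fin (3 + 3 * m)), false).1 ∧ x.2 = true ∧ ((k : Fin (3 + 3 * m)), false).2 = false then (-1 : ℤ) else 0)) * (M (w, !ct w) ((k' : Fin (3 + 3 * m)), true) * M (v, !ct v) ((k : Fin (3 + 3 * m)), true)) + (∑ x : Fin (3 + 3 * m) × Bool, M' x (j, ct j) * (if x.1 = ((k' : Fin (3 + 3 * m)), true).1 ∧ x.2 = false ∧ ((k' : Fin (3 + 3 * m)), true).2 = true then (1 : ℤ) else if x.1 = ((k' : Fin (3 + 3 * m)), true).1 ∧ x.2 = true ∧ ((k' : Fin (3 + 3 * m)), true).2 = false then (-1 : ℤ) else 0)) *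 (M (w, !ct w) ((k : Fin (3 + 3 * m)), true) * M (v, !ct v) ((k : Fin (3 + 3 * m)), false)))) ) else (1 : FreeGroup (Fin (3 + 3 * m))))).prod)).prod) :=
    pp_congr _ _ _ _ fun v w _ => by
      congr 1
      exact sign_mul_sign_mul (ct j) _
  rw [key]
  exact hread


end ConjRealiser

/-! ## §3 Permuted conjugated seed realisers at genus `3 + 3m` with collapsed readings -/

section PermRealiser

variable {m : ℕ}

/-- **A permuted conjugated seed realiser and its collapsed reading** (every genus `3 + 3m`).  For a matrix `M`
(inverse `M'`, sign `ε`) passing the Goeritz checks, a residue-preserving handle permutation `τ` (inverse `σ`) and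
handles `k, k' ≡ k + 1`, the conjugate `y = x bp_{k,k'} x⁻¹` of the bounding-pair map by a Goeritz element `x` realising
`P_σ M` lies in `Stab N₀ ∩ Stab N₁`, is IA, and reads through `π` as the collapsed closed form `RD'` of the module
docstring. [folklore] -/
theorem exists_perm_conj_realiser_g (k k' : Fin (3 + 3 * m)) (hkk' : ((k' : Fin (3 + 3 * m)) : ℕ) = (((k : Fin (3 + 3 * m)) : ℕ) + 1) % (3 + 3 * m)) (M M' : Matrix (Fin (3 + 3 * m) × Bool) (Fin (3 + 3 * m) × Bool) ℤ) (ε : ℤ) (hε : ε = 1 ∨ ε = -1)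
    (h1 : M * M' = 1) (h2 : M' * M = 1)
    (hS : ∀ x y : Fin (3 + 3 * m) × Bool, symplForm (fun q => M q x) (fun q => M q y) =
      ε * symplForm (Pi.single x (1 : ℤ) : Fin (3 + 3 * m) × Bool → ℤ) (Pi.single y (1 : ℤ)))
    (h0 : ∀ i j : Fin (3 + 3 * m), M (i, !decide ((i : ℕ) % 3 = 2)) (j, decide ((j : ℕ) % 3 = 2)) = 0)
    (h1' : ∀ i j : Fin (3 + 3 * m), M (i, !decide ((i : ℕ) % 3 = 1)) (j, decide ((j : ℕ) % 3 = 1)) = 0)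
    (τ σ : Fin (3 + 3 * m) → Fin (3 + 3 * m)) (hστ : ∀ h, σ (τ h) = h) (hτσ : ∀ h, τ (σ h) = h)
    (hτ : ∀ h : Fin (3 + 3 * m), ((τ h : Fin (3 + 3 * m)) : ℕ) % 3 = ((h : Fin (3 + 3 * m)) : ℕ) % 3)
    {ct : Fin (3 + 3 * m) → Bool} {π : (SurfaceGroup (3 + 3 * m)) →* (FreeGroup (Fin (3 + 3 * m)))} (hπs : Function.Surjective π)
    (hπof : ∀ (h : Fin (3 + 3 * m)) (b : Bool), π (PresentedGroup.of (h, b)) = if b = ct h then 1 else FreeGroup.of h) :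
    ∃ y : (SurfaceGroup (3 + 3 * m)) ≃* (SurfaceGroup (3 + 3 * m)),
      (s4Kernels.stabilizeIter m 0).map y.toMonoidHom = s4Kernels.stabilizeIter m 0 ∧
      (s4Kernels.stabilizeIter m 1).map y.toMonoidHom = s4Kernels.stabilizeIter m 1 ∧
      (∀ s : (SurfaceGroup (3 + 3 * m)), y s * s⁻¹ ∈ ((⊤ : Subgroup (SurfaceGroup (3 + 3 * m))).lowerCentralSeries 1)) ∧
      ∀ j : Fin (3 + 3 * m), π (y (PresentedGroup.of (j, ct j)) * (PresentedGroup.of (j, ct j))⁻¹) *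
        (((List.finRange (3 + 3 * m)).map (fun v => ((List.finRange (3 + 3 * m)).map (fun w => if v < w then ⁅(FreeGroup.of v : FreeGroup (Fin (3 + 3 * m))), FreeGroup.of w⁆ ^ ((if ct j then (-1 : ℤ) else 1) * ((if ct j then (-1 : ℤ) else 1) * ((M' ((k : Fin (3 + 3 * m)), false) (τ j, ct j) * (M (τ v, !ct v) ((k : Fin (3 + 3 * m)), false) * M (τ w, !ct w) ((k' : Fin (3 + 3 * m)), true)) + -M' ((k : Fin (3 + 3 * m)), true) (τ j, ct j) * (M (τ v, !ct v) ((k' : Fin (3 + 3 * m)), true) * M (τ w, !ct w) ((k : Fin (3 + 3 * m)), true)) + M' ((k' : Fin (3 + 3 * m)), false) (τ j, ct j) * (M (τ v, !ct v) ((k : Fin (3 + 3 * m)), true) * M (τ w, !ct w) ((k : Fin (3 + 3 * m)), false))) - (M' ((k : Fin (3 + 3 * m)), false) (τ j, ct j) * (M (τ w, !ct w) ((k : Fin (3 + 3 * m)), false) * M (τ v, !ct v) ((k' : Fin (3 + 3 * m)), true)) + -M' ((k : Fin (3 + 3 * m)), true) (τ j, ct j) * (M (τ w, !ct w) ((k'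 : Fin (3 + 3 * m)), true) * M (τ v, !ct v) ((k : Fin (3 + 3 * m)), true)) + M' ((k' : Fin (3 + 3 * m)), false) (τ j, ct j) * (M (τ w, !ct w) ((k : Fin (3 + 3 * m)), true) * M (τ v, !ct v) ((k : Fin (3 + 3 * m)), false)))))) else (1 : FreeGroup (Fin (3 + 3 * m))))).prod)).prod)⁻¹ ∈ ((⊤ : Subgroup (FreeGroup (Fin (3 + 3 * m)))).lowerCentralSeries 2) := by
  obtain ⟨y, hy0, hy1, hyIA, hyD⟩ := exists_conj_realiser_g k k' hkk'
    (Matrix.of (fun p q : Fin (3 + 3 * m) × Bool => M (τ p.1, p.2) q)) (Matrix.of (fun p q : Fin (3 + 3 * m) × Bool => M' p (τ q.1, q.2))) ε hε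
    (perm_mul_eq_one τ σ hστ M M' h1) (perm_mul_eq_one' τ σ hστ hτσ M M' h2) (perm_symplForm_col τ σ hστ hτσ M ε hS)
    (perm_block τ M 2 hτ h0) (perm_block τ M 1 hτ h1') hπs hπof
  refine ⟨y, hy0, hy1, hyIA, fun j => ?_⟩
  have key : (((List.finRange (3 + 3 * m)).map (fun v => ((List.finRange (3 + 3 * m)).map (fun w => if v < w then ⁅(FreeGroup.of v : FreeGroup (Fin (3 + 3 * m))), FreeGroup.of w⁆ ^ ((if ct j then (-1 : ℤ) else 1) * ((if ct j then (-1 : ℤ) else 1) * (((∑ x : Fin (3 + 3 * m) × Bool, (Matrix.of (fun p q : Fin (3 + 3 * m) × Bool => M' p (τ q.1, q.2))) x (j, ct j) * (if x.1 = ((k : Fin (3 + 3 * m)), true).1 ∧ x.2 = false ∧ ((k : Fin (3 + 3 * m)), true).2 = true then (1 : ℤ) else if x.1 = ((k : Fin (3 + 3 * m)), true).1 ∧ x.2 = true ∧ ((k : Fin (3 + 3 * m)), true).2 = false then (-1 : ℤ) else 0)) * ((Matrix.of (fun p q : Fin (3 + 3 * m) × Bool => M (τ p.1, p.2) q)) (v,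 !ct v) ((k : Fin (3 + 3 * m)), false) * (Matrix.of (fun p q : Fin (3 + 3 * m) × Bool => M (τ p.1, p.2) q)) (w, !ct w) ((k' : Fin (3 + 3 * m)), true)) + (∑ x : Fin (3 + 3 * m) × Bool, (Matrix.of (fun p q : Fin (3 + 3 * m) × Bool => M' p (τ q.1, q.2))) x (j, ct j) * (if x.1 = ((k : Fin (3 + 3 * m)), false).1 ∧ x.2 = false ∧ ((k : Fin (3 + 3 * m)), false).2 = true then (1 : ℤ) else if x.1 = ((k : Fin (3 + 3 * m)), false).1 ∧ x.2 = true ∧ ((k : Fin (3 + 3 * m)), false).2 = false then (-1 : ℤ) else 0)) * ((Matrix.of (fun p q : Fin (3 + 3 * m) × Bool => M (τ p.1, p.2) q)) (v, !ct v) ((k' : Fin (3 + 3 * m)), true) * (Matrix.of (fun p q : Fin (3 + 3 * m) × Bool => M (τ p.1, p.2) q)) (w, !ct w) ((k : Fin (3 + 3 * m)), true)) + (∑ x : Fin (3 + 3 * m) × Bool, (Matrix.of (fun p q : Fin (3 + 3 * m) × Bool => M' p (τ q.1, q.2))) x (j, ct j) * (if x.1 = ((k' : Fin (3 + 3 * m)),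 true).1 ∧ x.2 = false ∧ ((k' : Fin (3 + 3 * m)), true).2 = true then (1 : ℤ) else if x.1 = ((k' : Fin (3 + 3 * m)), true).1 ∧ x.2 = true ∧ ((k' : Fin (3 + 3 * m)), true).2 = false then (-1 : ℤ) else 0)) * ((Matrix.of (fun p q : Fin (3 + 3 * m) × Bool => M (τ p.1, p.2) q)) (v, !ct v) ((k : Fin (3 + 3 * m)), true) * (Matrix.of (fun p q : Fin (3 + 3 * m) × Bool => M (τ p.1, p.2) q)) (w, !ct w) ((k : Fin (3 + 3 * m)), false))) - ((∑ x : Fin (3 + 3 * m) × Bool, (Matrix.of (fun p q : Fin (3 + 3 * m) × Bool => M' p (τ q.1, q.2))) x (j, ct j) * (if x.1 = ((k : Fin (3 + 3 * m)), true).1 ∧ x.2 = false ∧ ((k : Fin (3 + 3 * m)), true).2 = true then (1 : ℤ) else if x.1 = ((k : Fin (3 + 3 * m)), true).1 ∧ x.2 = true ∧ ((k : Fin (3 + 3 * m)), true).2 = false then (-1 : ℤ) else 0)) * ((Matrix.of (fun p q : Fin (3 + 3 * m) × Bool => M (τ p.1, p.2) q)) (w, !ct w) ((k : Fin (3 + 3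 * m)), false) * (Matrix.of (fun p q : Fin (3 + 3 * m) × Bool => M (τ p.1, p.2) q)) (v, !ct v) ((k' : Fin (3 + 3 * m)), true)) + (∑ x : Fin (3 + 3 * m) × Bool, (Matrix.of (fun p q : Fin (3 + 3 * m) × Bool => M' p (τ q.1, q.2))) x (j, ct j) * (if x.1 = ((k : Fin (3 + 3 * m)), false).1 ∧ x.2 = false ∧ ((k : Fin (3 + 3 * m)), false).2 = true then (1 : ℤ) else if x.1 = ((k : Fin (3 + 3 * m)), false).1 ∧ x.2 = true ∧ ((k : Fin (3 + 3 * m)), false).2 = false then (-1 : ℤ) else 0)) * ((Matrix.of (fun p q : Fin (3 + 3 * m) × Bool => M (τ p.1, p.2) q)) (w, !ct w) ((k' : Fin (3 + 3 * m)), true) * (Matrix.of (fun p q : Fin (3 + 3 * m) × Bool => M (τ p.1, p.2) q)) (v, !ct v) ((k : Fin (3 + 3 * m)), true)) + (∑ x : Fin (3 + 3 * m) × Bool, (Matrix.of (fun p q : Fin (3 + 3 * m) × Bool => M' p (τ q.1, q.2))) x (j, ct j) * (if x.1 = ((k' : Fin (3 + 3 * m)), true).1 ∧ x.2 = false ∧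 ((k' : Fin (3 + 3 * m)), true).2 = true then (1 : ℤ) else if x.1 = ((k' : Fin (3 + 3 * m)), true).1 ∧ x.2 = true ∧ ((k' : Fin (3 + 3 * m)), true).2 = false then (-1 : ℤ) else 0)) * ((Matrix.of (fun p q : Fin (3 + 3 * m) × Bool => M (τ p.1, p.2) q)) (w, !ct w) ((k : Fin (3 + 3 * m)), true) * (Matrix.of (fun p q : Fin (3 + 3 * m) × Bool => M (τ p.1, p.2) q)) (v, !ct v) ((k : Fin (3 + 3 * m)), false)))))) else (1 : FreeGroup (Fin (3 + 3 * m))))).prod)).prod) =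
      (((List.finRange (3 + 3 * m)).map (fun v => ((List.finRange (3 + 3 * m)).map (fun w => if v < w then ⁅(FreeGroup.of v : FreeGroup (Fin (3 + 3 * m))), FreeGroup.of w⁆ ^ ((if ct j then (-1 : ℤ) else 1) * ((if ct j then (-1 : ℤ) else 1) * ((M' ((k : Fin (3 + 3 * m)), false) (τ j, ct j) * (M (τ v, !ct v) ((k : Fin (3 + 3 * m)), false) * M (τ w, !ct w) ((k' : Fin (3 + 3 * m)), true)) + -M' ((k : Fin (3 + 3 * m)), true) (τ j, ct j) * (M (τ v, !ct v) ((k' : Fin (3 + 3 * m)), true) * M (τ w, !ct w) ((k : Fin (3 + 3 * m)), true)) + M' ((k' : Fin (3 + 3 * m)), false) (τ j, ct j) * (M (τ v, !ct v) ((k : Fin (3 + 3 * m)), true) * M (τ w, !ct w) ((k : Fin (3 + 3 * m)), false))) - (M' ((k : Fin (3 + 3 * m)), false) (τ j, ct j) * (M (τ w, !ct w) ((k : Fin (3 + 3 * m)), false) * M (τ v, !ct v) ((k' : Fin (3 + 3 * m)), true)) + -M' ((k : Fin (3 + 3 * m)), true) (τ j, ct j) * (M (τ w, !ct w) ((k'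 : Fin (3 + 3 * m)), true) * M (τ v, !ct v) ((k : Fin (3 + 3 * m)), true)) + M' ((k' : Fin (3 + 3 * m)), false) (τ j, ct j) * (M (τ w, !ct w) ((k : Fin (3 + 3 * m)), true) * M (τ v, !ct v) ((k : Fin (3 + 3 * m)), false)))))) else (1 : FreeGroup (Fin (3 + 3 * m))))).prod)).prod) :=
    pp_congr _ _ _ _ fun v w _ => by
      congr 1
      rw [sum_mul_pairing_true, sum_mul_pairing_true, sum_mul_pairing_false]
      simp only [Matrix.of_apply]
  rw [← key]
  exact hyD j


end PermRealiser

/-! ## Registered helper -/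

/-- **Registered helper `helper_bpPair`** (sub-goal of stub `stub_layerStepBlockZero`, crux stmt-SmoothPoincare4-14595;
the file's main theorems exceed the registry's signature size): the bounding-pair map on the handles `k, k' ≡ k + 1` of
`S_g`, `g = n + 3` — IA, realising `(b_k, a_k, b_{k'})`, stabilising every cut kernel — in closed form (commutators
spelled out). [folklore] -/
theorem helper_bpPair : ∀ (g n : ℕ), g = n + 3 → ∀ (k k' : Fin g), ((k' : Fin g) : ℕ) = (((k : Fin g) : ℕ) + 1) % g → ∃ β : SurfaceGroup g ≃* SurfaceGroup g, (∀ s : SurfaceGroup g, β s * s⁻¹ ∈ (⊤ : Subgroup (SurfaceGroup g)).lowerCentralSeries 1) ∧ (∀ x : Fin g × Bool, β (PresentedGroup.of x : SurfaceGroup g) * (PresentedGroup.of x : SurfaceGroup g)⁻¹ * (((PresentedGroup.of (k, false) : SurfaceGroup g) * (PresentedGroup.of (k', true) : SurfaceGroup g) * (PresentedGroup.of (k, false) : SurfaceGroup g)⁻¹ * (PresentedGroup.of (k', true) : SurfaceGroup g)⁻¹) ^ (if x.1 = (k, true).1 ∧ x.2 = false ∧ (k, true).2 = true then (1 : ℤ)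 else if x.1 = (k, true).1 ∧ x.2 = true ∧ (k, true).2 = false then (-1 : ℤ) else 0) * ((PresentedGroup.of (k', true) : SurfaceGroup g) * (PresentedGroup.of (k, true) : SurfaceGroup g) * (PresentedGroup.of (k', true) : SurfaceGroup g)⁻¹ * (PresentedGroup.of (k, true) : SurfaceGroup g)⁻¹) ^ (if x.1 = (k, false).1 ∧ x.2 = false ∧ (k, false).2 = true then (1 : ℤ) else if x.1 = (k, false).1 ∧ x.2 = true ∧ (k, false).2 = false then (-1 : ℤ) else 0) * ((PresentedGroup.of (k, true) : SurfaceGroup g) * (PresentedGroup.of (k, false) : SurfaceGroup g) * (PresentedGroup.of (k, true) : SurfaceGroup g)⁻¹ * (PresentedGroup.of (k, false) : SurfaceGroup g)⁻¹) ^ (if x.1 = (k', true).1 ∧ x.2 = false ∧ (k', true).2 = true then (1 : ℤ) else if x.1 = (k', true).1 ∧ x.2 = true ∧ (k', true).2 = false then (-1 : ℤ) else 0))⁻¹ ∈ (⊤ : Subgroup (SurfaceGroup g)).lowerCentralSeries 2) ∧ ∀ c : Fin g → Bool, (SurfaceGroup.cutKernel c).map β.toMonoidHom = SurfaceGroup.cutKernel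 c :=
  fun _ n hg k k' hkk' => exists_bp_pair n hg k k' hkk'

end Summit.SmoothPoincare4.SmoothPoincare4.Theorems.ShadowApproximation.NilpotentGenusClass

end
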